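import Mathlib
import Summits.KontsevichZagierPeriods.Zeta5Search.Elimination.DictStarTopCore
import Summits.KontsevichZagierPeriods.Zeta5Search.Elimination.PencilTransport
import HarnessLib

/-!
# The zero-slot STAR in every slot pair (cell `pub-zeta5`, fam-elim E-L25c)

HONEST FRAMING: systematic search; no irrationality claim unless certified.  Identities among gen-1's
rational dictionary coefficients `U, W, V` and their slot-7 Plücker coordinates `casUW, casUV, casVW`; no
cellular integral, no numerics, nothing moves a record.

OUR work (Summit side; fam-elim gen 25, 2026-08-21).  `DictStarTopCore.starWedgeB` is the gauge-free STAR at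
the slot pair `(1,7)`: with `π_s(P) = P_s∏_{m≠s}(P₀+1−P_s−P_m)` (`starPi`) and `X ∈ {U∧W, U∧V, V∧W}`,
`(d(P)+1)·starKappa(P,1,7)·X(P) + π₇(P)·X(P−e₇) − π₁(P)·X(P−e₁) = 0` (`StarW P 1 7`, `starW_one_seven`).
Since the slot-7 wedges are invariant under EVERY relabelling `σ ∈ S₇` of the lower slots
(`PencilTransport.cas_permLower`) and `π`, `starKappa`, `d` relabel covariantly (`starPi_permLower`), the
relation transports to every ordered slot pair (`starW_of_perm`, `star_wedge`): `StarW P i k` holds for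
`i ≠ k` in `[1,7]` whenever `P` is in the box with `d(P) ≥ 0`, all slots `≤ P₀`, `P_i, P_k ≥ 1` and
`P_k + 1 ≤ P₀` — in particular at points with ZERO slots, where E-L19's interior argument (`dictStar_at`, two
pencils through `P − DS`) does not reach.  The file `DictStarTop` adds the gauge and closes gen-1's `DictStar`.

References: [Zudilin2002c] W. Zudilin, arXiv:math/0206176 (2002), §8; [Brown2014] F. Brown, arXiv:1412.6508.
-/

open Finset

namespace Summit.KontsevichZagierPeriods.Zeta5Search.Elimination

open Summit.KontsevichZagierPeriods.Zeta5Search.DualSeries (InBox)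
open Summit.KontsevichZagierPeriods.Zeta5Search.WedgeDictionary
open Summit.KontsevichZagierPeriods.Zeta5Search.SymmetricGauge
open Literature.NumberTheory.Irrationality.BrownZudilin2022 (bOfA Converges QOf convergenceForms)

/-! ## 1. Lowered points, the coefficient `π_s`, the gauge-free STAR relation -/

/-- `P − e_s`. -/
def lowerAt (P : ℕ → ℤ) (s : ℕ) : ℕ → ℤ := Function.update P s (P s - 1)

/-- Values of `P − e_s`. -/
theorem lowerAt_apply (P : ℕ → ℤ) (s n : ℕ) : lowerAt P s n = if n = s then P s - 1 else P n := by
  unfold lowerAt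
  exact Function.update_apply _ _ _ _

/-- `(P − e_s)₀ = P₀` for `s ≠ 0`. -/
theorem lowerAt_zero (P : ℕ → ℤ) {s : ℕ} (hs : s ≠ 0) : lowerAt P s 0 = P 0 := by
  rw [lowerAt_apply, if_neg (fun h => hs h.symm)]

/-- `P − e_s ≤ P` slotwise. -/
theorem lowerAt_le (P : ℕ → ℤ) (s n : ℕ) : lowerAt P s n ≤ P n := by
  rw [lowerAt_apply]
  split_ifs with h
  · rw [h]; omega
  · exact le_rfl

/-- `(P − e_{m+1}) + e_{m+1} = P`. -/
theorem bump_lowerAt (P : ℕ → ℤ) (m : ℕ) : bump (lowerAt P (m + 1)) m = P := by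
  funext n
  by_cases h : n = m + 1
  · rw [h, bump_self, lowerAt_apply, if_pos rfl]; ring
  · rw [bump_of_ne _ h, lowerAt_apply, if_neg h]

/-- `d(P − e_{m+1}) = d(P) + 1`. -/
theorem dOf_lowerAt (P : ℕ → ℤ) {m : ℕ} (hm : m < 7) : dOf (lowerAt P (m + 1)) = dOf P + 1 := by
  have := dOf_bump (lowerAt P (m + 1)) (i := m) (mem_range.2 hm)
  rw [bump_lowerAt] at this
  omega

/-- `P − e_s` stays in the box when `P_s ≥ 1`. -/
theorem inBox_lowerAt {P : ℕ → ℤ} (hP : InBox P) {s : ℕ} (hs : s ≠ 0) (h1 : 1 ≤ P s) : InBox (lowerAt P s) := by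
  refine ⟨by rw [lowerAt_zero P hs]; exact hP.1, fun j hj => ?_⟩
  rw [lowerAt_zero P hs, lowerAt_apply]
  have := hP.2 j hj
  split_ifs with h
  · rw [h] at this; omega
  · exact this

/-- `π_s(P) = P_s · ∏_{m∈[1,7], m≠s} (P₀ + 1 − P_s − P_m)`: the STAR coefficient of the member `P − e_s`. -/
def starPi (P : ℕ → ℤ) (s : ℕ) : ℚ :=
  (P s : ℚ) * ∏ m ∈ range 7, (if m + 1 = s then (1 : ℚ) else ((P 0 : ℚ) + 1 - P s - P (m + 1)))

/-- **The gauge-free STAR relation** at `P` for the ordered slot pair `(i,k)`: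
`(d(P)+1)·starKappa(P,i,k)·X(P) + π_k(P)·X(P − e_k) − π_i(P)·X(P − e_i) = 0` for `X ∈ {U∧W, U∧V, V∧W}`
(a predicate in `P, i, k`, not a statement). -/
def StarW (P : ℕ → ℤ) (i k : ℕ) : Prop :=
  ∀ X ∈ [casUW, casUV, casVW],
    ((dOf P : ℚ) + 1) * (starKappa P i k : ℚ) * X P + starPi P k * X (lowerAt P k) -
      starPi P i * X (lowerAt P i) = 0

/-! ## 2. The slot pair `(1,7)`: `starWedgeB` read at `Q = x + e₁ + e₇` -/

/-- Composition of configuration shifts. -/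
theorem cfg_cfg (Q : ℕ → ℤ) (u v t u' v' t' : ℤ) :
    cfg (cfg Q u v t) u' v' t' = cfg Q (u + u') (v + v') (t + t') := by
  funext n
  by_cases h1 : n = 1
  · subst h1; simp only [cfg_one]; ring
  by_cases h2 : n = 2
  · subst h2; simp only [cfg_two]; ring
  by_cases h7 : n = 7
  · subst h7; simp only [cfg_seven]; ring
  simp only [cfg_of_ne _ _ _ _ h1 h2 h7]

/-- `Q − e₇` and `Q − e₁` as configuration points. -/
theorem cfg_lowerAt (Q : ℕ → ℤ) : cfg Q 0 0 (-1) = lowerAt Q 7 ∧ cfg Q (-1) 0 0 = lowerAt Q 1 := by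
  constructor
  · funext n
    rw [lowerAt_apply]
    by_cases h1 : n = 1
    · subst h1; rw [cfg_one, if_neg (by omega)]; ring
    by_cases h2 : n = 2
    · subst h2; rw [cfg_two, if_neg (by omega)]; ring
    by_cases h7 : n = 7
    · subst h7; rw [cfg_seven, if_pos rfl]; ring
    rw [cfg_of_ne _ _ _ _ h1 h2 h7, if_neg h7]
  · funext n
    rw [lowerAt_apply]
    by_cases h1 : n = 1
    · subst h1; rw [cfg_one, if_pos rfl]; ring
    by_cases h2 : n = 2
    · subst h2; rw [cfg_two, if_neg (by omega)]; ring
    by_cases h7 : n = 7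
    · subst h7; rw [cfg_seven, if_neg (by omega)]; ring
    rw [cfg_of_ne _ _ _ _ h1 h2 h7, if_neg h1]

/-- `Q`, `Q − e₇`, `Q − e₁` over the base `x = Q − e₁ − e₇`. -/
theorem cfg_lower17 (Q : ℕ → ℤ) :
    cfg (cfg Q (-1) 0 (-1)) 1 0 1 = Q ∧ cfg (cfg Q (-1) 0 (-1)) 1 0 0 = lowerAt Q 7 ∧
      cfg (cfg Q (-1) 0 (-1)) 0 0 1 = lowerAt Q 1 := by
  refine ⟨?_, ?_, ?_⟩
  · rw [cfg_cfg]; norm_num [cfg_base]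
  · rw [cfg_cfg]; norm_num [(cfg_lowerAt Q).1]
  · rw [cfg_cfg]; norm_num [(cfg_lowerAt Q).2]

/-- `Q − e₁ − e₇` is in the box when `Q` is and `Q₁, Q₇ ≥ 1`. -/
theorem inBox_cfg_lower (Q : ℕ → ℤ) (hQ : InBox Q) (h1 : 1 ≤ Q 1) (h7 : 1 ≤ Q 7) :
    InBox (cfg Q (-1) 0 (-1)) := by
  refine ⟨by rw [cfg_zero]; exact hQ.1, fun j hj => ?_⟩
  have hQ1 := hQ.2 0 (by simp)
  have hQ2 := hQ.2 1 (by simp)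
  have hQ7 := hQ.2 6 (by simp)
  have hQj := hQ.2 j hj
  simp only [Nat.reduceAdd] at hQ1 hQ2 hQ7
  rw [cfg_zero]
  by_cases e1 : j + 1 = 1
  · rw [e1, cfg_one]; omega
  by_cases e2 : j + 1 = 2
  · rw [e2, cfg_two]; omega
  by_cases e7 : j + 1 = 7
  · rw [e7, cfg_seven]; omega
  rw [cfg_of_ne Q _ _ _ e1 e2 e7]
  exact hQj

/-- The coefficients of `starWedgeB` at the base `Q − e₁ − e₇` are `(d(Q)+1)·starKappa(Q,1,7)`, `π₇(Q)`, `π₁(Q)`. -/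
theorem coeffs_lower17 (Q : ℕ → ℤ) :
    ((dOf (cfg Q (-1) 0 (-1)) : ℚ) - 1) * kapB (cfg Q (-1) 0 (-1)) = ((dOf Q : ℚ) + 1) * (starKappa Q 1 7 : ℚ) ∧
      piB7 (cfg Q (-1) 0 (-1)) = starPi Q 7 ∧ piB1 (cfg Q (-1) 0 (-1)) = starPi Q 1 := by
  have x3 : cfg Q (-1) 0 (-1) 3 = Q 3 := cfg_of_ne Q _ _ _ (by omega) (by omega) (by omega)
  have x4 : cfg Q (-1) 0 (-1) 4 = Q 4 := cfg_of_ne Q _ _ _ (by omega) (by omega) (by omega)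
  have x5 : cfg Q (-1) 0 (-1) 5 = Q 5 := cfg_of_ne Q _ _ _ (by omega) (by omega) (by omega)
  have x6 : cfg Q (-1) 0 (-1) 6 = Q 6 := cfg_of_ne Q _ _ _ (by omega) (by omega) (by omega)
  refine ⟨?_, ?_, ?_⟩
  · rw [dOf_cfg]
    simp only [kapB, starKappa, cfg_zero, cfg_one, cfg_seven]
    push_cast
    ring
  · simp only [piB7, starPi, prod_range_succ, prod_range_zero, cfg_zero, cfg_one, cfg_two, cfg_seven, x3, x4,
      x5, x6, one_mul]
    norm_num [-mul_eq_mul_left_iff, -mul_eq_mul_right_iff]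
    ring
  · simp only [piB1, starPi, prod_range_succ, prod_range_zero, cfg_zero, cfg_one, cfg_two, cfg_seven, x3, x4,
      x5, x6, one_mul]
    norm_num [-mul_eq_mul_left_iff, -mul_eq_mul_right_iff]
    ring

/-- **STAR at the slot pair `(1,7)`.** For `Q` in the box with `d(Q) ≥ 0`, `Q₁, Q₇ ≥ 1` and `Q₇ + 1 ≤ Q₀`:
`StarW Q 1 7`. -/
theorem starW_one_seven (Q : ℕ → ℤ) (hQ : InBox Q) (hd : 0 ≤ dOf Q) (h1 : 1 ≤ Q 1) (h7 : 1 ≤ Q 7)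
    (h70 : Q 7 + 1 ≤ Q 0) : StarW Q 1 7 := by
  have hQ1 := hQ.2 0 (by simp)
  simp only [Nat.reduceAdd] at hQ1
  have hx := inBox_cfg_lower Q hQ h1 h7
  have W := starWedgeB (cfg Q (-1) 0 (-1)) hx (by rw [dOf_cfg]; omega) (by rw [cfg_seven, cfg_zero]; omega)
    (by rw [cfg_one, cfg_zero]; omega)
  obtain ⟨e0, e7, e1⟩ := cfg_lower17 Q
  obtain ⟨ck, c7, c1⟩ := coeffs_lower17 Q
  rw [e0, e7, e1, ck, c7, c1] at W
  exact W

/-! ## 3. Transport along `S₇` -/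

/-- The values of `σ • P`. -/
theorem permLower_vals (σ : Equiv.Perm (Fin 7)) (P : ℕ → ℤ) :
    permLower σ P 0 = P 0 ∧ permLower σ P 1 = P ((σ 0).val + 1) ∧ permLower σ P 2 = P ((σ 1).val + 1) ∧
      permLower σ P 3 = P ((σ 2).val + 1) ∧ permLower σ P 4 = P ((σ 3).val + 1) ∧
      permLower σ P 5 = P ((σ 4).val + 1) ∧ permLower σ P 6 = P ((σ 5).val + 1) ∧
      permLower σ P 7 = P ((σ 6).val + 1) :=
  ⟨permLower_zero σ P, permLower_apply_succ σ P 0, permLower_apply_succ σ P 1, permLower_apply_succ σ P 2,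
    permLower_apply_succ σ P 3, permLower_apply_succ σ P 4, permLower_apply_succ σ P 5,
    permLower_apply_succ σ P 6⟩

/-- Lowering commutes with relabelling: `σ • (P − e_{σ(m)+1}) = (σ • P) − e_{m+1}`. -/
theorem permLower_lowerAt (σ : Equiv.Perm (Fin 7)) (P : ℕ → ℤ) (m : Fin 7) :
    permLower σ (lowerAt P ((σ m).val + 1)) = lowerAt (permLower σ P) (m.val + 1) := by
  funext n
  by_cases hn : 1 ≤ n ∧ n ≤ 7
  · obtain ⟨l, rfl⟩ : ∃ l : Fin 7, n = l.val + 1 := ⟨⟨n - 1, by omega⟩, by simp only; omega⟩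
    simp only [lowerAt_apply, permLower_apply_succ]
    by_cases hl : l = m
    · subst hl; simp
    · rw [if_neg (fun e => hl (σ.injective (Fin.ext (by omega)))), if_neg (fun e => hl (Fin.ext (by omega)))]
  · have h1 : n ≠ (σ m).val + 1 := by have := (σ m).isLt; omega
    have h2 : n ≠ m.val + 1 := by have := m.isLt; omega
    rw [permLower_apply_of_not σ _ hn, lowerAt_apply, lowerAt_apply, if_neg h1, if_neg h2,
      permLower_apply_of_not σ _ hn]

/-- `(σ • P) − e₇ = σ • (P − e_{σ(6)+1})`. -/
theorem lowerAt_permLower_seven (σ : Equiv.Perm (Fin 7)) (P : ℕ → ℤ) :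
    lowerAt (permLower σ P) 7 = permLower σ (lowerAt P ((σ 6).val + 1)) :=
  (permLower_lowerAt σ P 6).symm

/-- `(σ • P) − e₁ = σ • (P − e_{σ(0)+1})`. -/
theorem lowerAt_permLower_one (σ : Equiv.Perm (Fin 7)) (P : ℕ → ℤ) :
    lowerAt (permLower σ P) 1 = permLower σ (lowerAt P ((σ 0).val + 1)) :=
  (permLower_lowerAt σ P 0).symm

/-- `π` relabels covariantly: `π_{m+1}(σ • P) = π_{σ(m)+1}(P)`. -/
theorem starPi_permLower (σ : Equiv.Perm (Fin 7)) (P : ℕ → ℤ) (m : Fin 7) :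
    starPi (permLower σ P) (m.val + 1) = starPi P ((σ m).val + 1) := by
  unfold starPi
  rw [permLower_apply_succ, permLower_zero]
  simp only [Finset.prod_range]
  congr 1
  refine Fintype.prod_equiv σ _ _ fun l => ?_
  simp only [permLower_apply_succ]
  by_cases h : l = m
  · subst h; simp
  · have h1 : l.val + 1 ≠ m.val + 1 := fun e => h (Fin.ext (by omega))
    have h2 : (σ l).val + 1 ≠ (σ m).val + 1 := fun e => h (σ.injective (Fin.ext (by omega)))
    rw [if_neg h1, if_neg h2]

/-- `π₇(σ • P) = π_{σ(6)+1}(P)`. -/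
theorem starPi_permLower_seven (σ : Equiv.Perm (Fin 7)) (P : ℕ → ℤ) :
    starPi (permLower σ P) 7 = starPi P ((σ 6).val + 1) :=
  starPi_permLower σ P 6

/-- `π₁(σ • P) = π_{σ(0)+1}(P)`. -/
theorem starPi_permLower_one (σ : Equiv.Perm (Fin 7)) (P : ℕ → ℤ) :
    starPi (permLower σ P) 1 = starPi P ((σ 0).val + 1) :=
  starPi_permLower σ P 0

/-- `starKappa(σ • P, 1, 7) = starKappa(P, σ(0)+1, σ(6)+1)`. -/
theorem starKappa_permLower (σ : Equiv.Perm (Fin 7)) (P : ℕ → ℤ) :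
    starKappa (permLower σ P) 1 7 = starKappa P ((σ 0).val + 1) ((σ 6).val + 1) := by
  obtain ⟨v0, v1, -, -, -, -, -, v7⟩ := permLower_vals σ P
  unfold starKappa
  rw [v0, v1, v7]

/-- **Transport along `σ ∈ S₇`.**  `StarW (σ • P) 1 7` gives `StarW P (σ(0)+1) (σ(6)+1)` for `P` in the box
with `d(P) ≥ 0`, all slots `≤ P₀` and `P_{σ(0)+1}, P_{σ(6)+1} ≥ 1`: the slot-7 wedges are `S₇`-invariant
(`cas_permLower`) and the coefficients relabel covariantly. -/
theorem starW_of_perm (σ : Equiv.Perm (Fin 7)) (P : ℕ → ℤ) (hP : InBox P) (hd : 0 ≤ dOf P)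
    (hle : ∀ m ∈ Icc 1 7, P m ≤ P 0) (hi1 : 1 ≤ P ((σ 0).val + 1)) (hk1 : 1 ≤ P ((σ 6).val + 1))
    (hW : StarW (permLower σ P) 1 7) : StarW P ((σ 0).val + 1) ((σ 6).val + 1) := by
  have h7le : P 7 ≤ P 0 := hle 7 (by simp)
  have hkle : P ((σ 6).val + 1) ≤ P 0 := hle _ (mem_Icc.2 ⟨by omega, by have := (σ 6).isLt; omega⟩)
  have hIk : InBox (lowerAt P ((σ 6).val + 1)) := inBox_lowerAt hP (by omega) hk1
  have hIi : InBox (lowerAt P ((σ 0).val + 1)) := inBox_lowerAt hP (by omega) hi1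
  have hdk : 0 ≤ dOf (lowerAt P ((σ 6).val + 1)) := by rw [dOf_lowerAt P (σ 6).isLt]; omega
  have hdi : 0 ≤ dOf (lowerAt P ((σ 0).val + 1)) := by rw [dOf_lowerAt P (σ 0).isLt]; omega
  have hsk : lowerAt P ((σ 6).val + 1) ((σ 6).val + 1) ≤ lowerAt P ((σ 6).val + 1) 0 := by
    rw [lowerAt_zero P (by omega)]; exact (lowerAt_le P _ _).trans hkle
  have h7k : lowerAt P ((σ 6).val + 1) 7 ≤ lowerAt P ((σ 6).val + 1) 0 := by
    rw [lowerAt_zero P (by omega)]; exact (lowerAt_le P _ _).trans h7le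
  have hsi : lowerAt P ((σ 0).val + 1) ((σ 6).val + 1) ≤ lowerAt P ((σ 0).val + 1) 0 := by
    rw [lowerAt_zero P (by omega)]; exact (lowerAt_le P _ _).trans hkle
  have h7i : lowerAt P ((σ 0).val + 1) 7 ≤ lowerAt P ((σ 0).val + 1) 0 := by
    rw [lowerAt_zero P (by omega)]; exact (lowerAt_le P _ _).trans h7le
  have eP := cas_permLower σ P hP hd hkle h7le
  have eK := cas_permLower σ _ hIk hdk hsk h7k
  have eI := cas_permLower σ _ hIi hdi hsi h7i
  intro X hX
  have hWX := hW X hX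
  rw [dOf_permLower, starKappa_permLower, lowerAt_permLower_seven, lowerAt_permLower_one,
    starPi_permLower_seven, starPi_permLower_one] at hWX
  simp only [List.mem_cons, List.not_mem_nil, or_false] at hX
  rcases hX with rfl | rfl | rfl
  · rw [eP.1, eK.1, eI.1] at hWX; exact hWX
  · rw [eP.2.1, eK.2.1, eI.2.1] at hWX; exact hWX
  · rw [eP.2.2, eK.2.2, eI.2.2] at hWX; exact hWX

/-- **The gauge-free STAR in every ordered slot pair.**  For `i ≠ k` in `[1,7]` and `P` in the box with
`d(P) ≥ 0`, all slots `≤ P₀`, `P_i, P_k ≥ 1` and `P_k + 1 ≤ P₀` (zero slots elsewhere allowed): `StarW P i k`. -/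
theorem star_wedge (P : ℕ → ℤ) {i k : ℕ} (hi : i ∈ Icc 1 7) (hk : k ∈ Icc 1 7) (hik : i ≠ k) (hP : InBox P)
    (hd : 0 ≤ dOf P) (hle : ∀ m ∈ Icc 1 7, P m ≤ P 0) (hi1 : 1 ≤ P i) (hk1 : 1 ≤ P k)
    (hkN : P k + 1 ≤ P 0) : StarW P i k := by
  obtain ⟨hi1', hi7⟩ := mem_Icc.1 hi
  obtain ⟨hk1', hk7⟩ := mem_Icc.1 hk
  obtain ⟨i', rfl⟩ : ∃ i' : Fin 7, i = i'.val + 1 := ⟨⟨i - 1, by omega⟩, by simp only; omega⟩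
  obtain ⟨k', rfl⟩ : ∃ k' : Fin 7, k = k'.val + 1 := ⟨⟨k - 1, by omega⟩, by simp only; omega⟩
  have hik' : i' ≠ k' := fun h => hik (by rw [h])
  -- a relabelling `σ` with `σ(0) = i'`, `σ(6) = k'`
  have hr : Equiv.swap (0 : Fin 7) i' k' ≠ 0 := fun h => hik' (by
    have := congrArg (Equiv.swap (0 : Fin 7) i') h
    rw [Equiv.swap_apply_self, Equiv.swap_apply_left] at this
    exact this.symm)
  have hσ6 : (Equiv.swap (0 : Fin 7) i' * Equiv.swap 6 (Equiv.swap (0 : Fin 7) i' k')) 6 = k' := by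
    rw [Equiv.Perm.mul_apply, Equiv.swap_apply_left, Equiv.swap_apply_self]
  have hσ0 : (Equiv.swap (0 : Fin 7) i' * Equiv.swap 6 (Equiv.swap (0 : Fin 7) i' k')) 0 = i' := by
    rw [Equiv.Perm.mul_apply, Equiv.swap_apply_of_ne_of_ne (by decide) hr.symm, Equiv.swap_apply_left]
  obtain ⟨σ, hσ0, hσ6⟩ : ∃ σ : Equiv.Perm (Fin 7), σ 0 = i' ∧ σ 6 = k' := ⟨_, hσ0, hσ6⟩
  obtain ⟨v0, v1, -, -, -, -, -, v7⟩ := permLower_vals σ P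
  rw [hσ0] at v1
  rw [hσ6] at v7
  have hW : StarW (permLower σ P) 1 7 :=
    starW_one_seven (permLower σ P) (inBox_permLower σ hP) (by rw [dOf_permLower]; exact hd) (by rw [v1]; exact hi1)
      (by rw [v7]; exact hk1) (by rw [v7, v0]; exact hkN)
  have T := starW_of_perm σ P hP hd hle (by rw [hσ0]; exact hi1) (by rw [hσ6]; exact hk1) hW
  rw [hσ0, hσ6] at T
  exact T

end Summit.KontsevichZagierPeriods.Zeta5Search.Elimination
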